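/-
Origin: written from primary sources — S. Kudla, *Seesaw dual reductive pairs* (1984) §1 (the see-saw identity for the
pair `(U(V) × U(V), U(W₁ ⊕ W₂))` versus `(U(V), U(W₁)) × (U(V), U(W₂))`: the period of the big theta kernel over
`[U(W₁) × U(W₂)]` is the product of the two small theta lifts); P. Fleig, H. P. A. Gustafsson, A. Kleinschmidt,
D. Persson, *Eisenstein Series and Automorphic Representations* (2018) §12.3 Definition 12.5 (12.37) (the theta lift as
a kernel integral). Adapted: no. Abstract over the tree's `ThetaKernelDatum` (`Weil1964/ThetaKernelDualPair`,
`Weil1964/ThetaLift`); the only analysis used is Fubini for a product of finite measures (`MeasureTheory.integral_prod_mul`).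
Kernel only; no records.
-/
import Literature.NumberTheory.Weil1964.ThetaWeightForms
import Mathlib.MeasureTheory.Integral.Prod
import HarnessLib

/-!
# The see-saw identity for theta LIFTS: the torus period of a product kernel is the product of the lifts

Three theta-kernel data sharing the first member `GU` of their dual pairs (tree `ThetaKernelDatum`):

* `M`  — the BIG pair `(GU, G)`, kernel `θ_Ψ` on `[GU] × [G]`;
* `M₁` — the small pair `(GU, U₁)`, kernel `θ¹_{Φ₁}` on `[GU] × [U₁]`, lift `Θ¹_{Φ₁}(f₁) ∈ C([GU])`;
* `M₂` — the small pair `(GU, U₂)`, kernel `θ²_{Φ₂}`, lift `Θ²_{Φ₂}(f₂)`;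

a homomorphism `bd : U₁ × U₂ →* G` (the see-saw torus `U(W₁) × U(W₂) ⊂ U(W₁ ⊕ W₂)`) carrying `Γ₁ × Γ₂` into `Γ`,
and test functions `Ψ, Φ₁, Φ₂` whose kernels MULTIPLY along `bd` on representatives
(`IsSeesawProduct`: `θ_Ψ(x, bd(u₁,u₂)) = θ¹_{Φ₁}(x, u₁) · θ²_{Φ₂}(x, u₂)` — for Weil's adelic theta kernels of a unitary
see-saw this is `GelbartRogawski1991/UnitaryDualPairSeesawThetaProduct.thetaKernelDatum_thetaFun_blockDiag_seesawTensor`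
with `Ψ = Φ₁ ⊗ Φ₂`).  Then (§2, **`seesaw_period_eq_thetaLift_mul`**): for all `f₁ ∈ C([U₁])`, `f₂ ∈ C([U₂])` and finite
measures `μ₁`, `μ₂`,

  `∫_{[U₁] × [U₂]} θ_Ψ(ξ, bd(q₁,q₂)) f₁(q₁) f₂(q₂) d(μ₁ ⊗ μ₂) = Θ¹_{Φ₁}(f₁)(ξ) · Θ²_{Φ₂}(f₂)(ξ)`   for every `ξ ∈ [GU]`

— the period of the big theta kernel over the see-saw torus against `f₁ ⊠ f₂` IS the product of the two theta lifts
[Kudla1984, §1] (PerL's (eq:seesaw) in the tree's currency; Fubini, no convergence issue since the quotients are compact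
and the measures finite).  §3 gives the antisymmetrised (WEDGE) form: for four test functions with pairwise product
kernels, the period of `θ_{φ₁₁ ⊗ φ₂₂} − θ_{φ₁₂ ⊗ φ₂₁}` is the `2 × 2` determinant
`Θ¹_{φ₁₁}(f₁) Θ²_{φ₂₂}(f₂) − Θ¹_{φ₁₂}(f₁) Θ²_{φ₂₁}(f₂)` — the global wedge-function of two vector-valued theta forms
whose components are the scalar lifts (`ThetaWeightForms.apply_thetaForm`) is a torus period of ONE big theta kernel.

§1 supplies the descended torus map `seesawQuot bd hbd : [U₁] × [U₂] → [G]` and its continuity.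

Provenance / use: Hodge-CM model-construction cell, rows `gen12`/`real34` — PKG consumer `Gen12FunBridge.wf_gen` of
`HodgeCM/Model/Binders/MeetBridges.lean` (PerL v5 (eq:seesaw), tex ll. 323–325: `θ(φ₁,χ′₁)(g) θ(φ₂,χ′₂)(g) =
∫_{[T]} θ_{φ₁⊗φ₂}(g,t) χ₁₂(t) dt`; the wedge form is (eq:Qaut), tex l. 249); the hypothesis `IsSeesawProduct` is supplied at
the splitting data of record by `GelbartRogawski1991/UnitaryDualPairSeesawThetaProduct`.  Nothing here is a claim of the
manuscripts under adjudication.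
-/

set_option autoImplicit false

noncomputable section

open _root_.MeasureTheory Function
open Literature.MeasureTheory.Integral

namespace Literature.NumberTheory.Weil1964

namespace ThetaKernelDatum

universe u v

/-! ## §1 The descended see-saw torus map `[U₁] × [U₂] → [G]` -/

section QuotMap

variable {U₁ : Type*} [Group U₁] {Γ₁ : Subgroup U₁} {U₂ : Type*} [Group U₂] {Γ₂ : Subgroup U₂}
variable {G : Type*} [Group G] {Γ : Subgroup G}
variable (bd : U₁ × U₂ →* G) (hbd : ∀ γ₁ ∈ Γ₁, ∀ γ₂ ∈ Γ₂, bd (γ₁, γ₂) ∈ Γ)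

include hbd in
/-- compatibility of `(u₁, u₂) ↦ bd(u₁,u₂) Γ` with the left-coset relations. [folklore] -/
theorem seesawQuot_compat {u₁ u₁' : U₁} {u₂ u₂' : U₂} (h₁ : u₁⁻¹ * u₁' ∈ Γ₁) (h₂ : u₂⁻¹ * u₂' ∈ Γ₂) :
    (QuotientGroup.mk (bd (u₁, u₂)) : G ⧸ Γ) = QuotientGroup.mk (bd (u₁', u₂')) := by
  refine QuotientGroup.eq.mpr ?_
  rw [← map_inv, ← map_mul, Prod.inv_mk, Prod.mk_mul_mk]
  exact hbd _ h₁ _ h₂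

/-- **the see-saw torus on quotients**: `(u₁ Γ₁, u₂ Γ₂) ↦ bd(u₁,u₂) Γ : [U₁] × [U₂] → [G]`. [cite: Kudla1984, §1] -/
def seesawQuot : (U₁ ⧸ Γ₁) × (U₂ ⧸ Γ₂) → G ⧸ Γ := fun q =>
  Quotient.liftOn₂' q.1 q.2 (fun u₁ u₂ => (QuotientGroup.mk (bd (u₁, u₂)) : G ⧸ Γ))
    (fun _ _ _ _ h₁ h₂ =>
      seesawQuot_compat bd hbd (QuotientGroup.leftRel_apply.mp h₁) (QuotientGroup.leftRel_apply.mp h₂))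

/-- on representatives: `seesawQuot (u₁ Γ₁, u₂ Γ₂) = bd(u₁,u₂) Γ`. [folklore] -/
@[simp] theorem seesawQuot_mk (u₁ : U₁) (u₂ : U₂) :
    seesawQuot bd hbd (QuotientGroup.mk u₁, QuotientGroup.mk u₂) = QuotientGroup.mk (bd (u₁, u₂)) :=
  rfl

/-- `seesawQuot` is continuous (for continuous `bd`). [folklore] -/
theorem continuous_seesawQuot [TopologicalSpace U₁] [IsTopologicalGroup U₁] [TopologicalSpace U₂]
    [IsTopologicalGroup U₂] [TopologicalSpace G] (hc : Continuous bd) : Continuous (seesawQuot bd hbd) := by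
  have hopen : IsOpenQuotientMap (Prod.map (QuotientGroup.mk : U₁ → U₁ ⧸ Γ₁) (QuotientGroup.mk : U₂ → U₂ ⧸ Γ₂)) :=
    (QuotientGroup.isOpenQuotientMap_mk (N := Γ₁)).prodMap (QuotientGroup.isOpenQuotientMap_mk (N := Γ₂))
  refine hopen.isQuotientMap.continuous_iff.mpr ?_
  have heq : seesawQuot bd hbd ∘ Prod.map QuotientGroup.mk QuotientGroup.mk =
      fun p : U₁ × U₂ => (QuotientGroup.mk (bd p) : G ⧸ Γ) := by
    funext p; rfl
  rw [heq]
  exact QuotientGroup.continuous_mk.comp hc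

end QuotMap

/-! ## §2 The period of a product kernel over the see-saw torus -/

section Product

variable {Mp : Type u} {SX : Type v} [TopologicalSpace Mp] [Group Mp] [TopologicalSpace SX]
variable {Mp₁ : Type*} {SX₁ : Type*} [TopologicalSpace Mp₁] [Group Mp₁] [TopologicalSpace SX₁]
variable {Mp₂ : Type*} {SX₂ : Type*} [TopologicalSpace Mp₂] [Group Mp₂] [TopologicalSpace SX₂]
variable {GU : Type*} [Group GU] [TopologicalSpace GU] [IsTopologicalGroup GU] {ΓU : Subgroup GU}
variable {G : Type*} [Group G] [TopologicalSpace G] [IsTopologicalGroup G] {Γ : Subgroup G}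
variable {U₁ : Type*} [Group U₁] [TopologicalSpace U₁] [IsTopologicalGroup U₁] {Γ₁ : Subgroup U₁}
variable {U₂ : Type*} [Group U₂] [TopologicalSpace U₂] [IsTopologicalGroup U₂] {Γ₂ : Subgroup U₂}
variable (M : ThetaKernelDatum Mp SX GU ΓU G Γ) (M₁ : ThetaKernelDatum Mp₁ SX₁ GU ΓU U₁ Γ₁)
  (M₂ : ThetaKernelDatum Mp₂ SX₂ GU ΓU U₂ Γ₂)
variable (bd : U₁ × U₂ →* G) (hbd : ∀ γ₁ ∈ Γ₁, ∀ γ₂ ∈ Γ₂, bd (γ₁, γ₂) ∈ Γ)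

/-- **Product kernels along the see-saw torus**: the big kernel of `Ψ` restricted to `GU × bd(U₁ × U₂)` is the
product of the two small kernels of `Φ₁`, `Φ₂`, on representatives:
`θ_Ψ(x, bd(u₁,u₂)) = θ¹_{Φ₁}(x, u₁) · θ²_{Φ₂}(x, u₂)` (tree convention `θ_Φ(x, y) = Θ_Φ(s(x,y)⁻¹)`).
A hypothesis PREDICATE (nothing asserted). [folklore] -/
def IsSeesawProduct (Ψ : SX) (Φ₁ : SX₁) (Φ₂ : SX₂) : Prop :=
  ∀ (x : GU) (u₁ : U₁) (u₂ : U₂), M.thetaFun Ψ (x, bd (u₁, u₂)) = M₁.thetaFun Φ₁ (x, u₁) * M₂.thetaFun Φ₂ (x, u₂)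

variable {M M₁ M₂ bd}

/-- **The descended kernels multiply**: `θ_Ψ(ξ, seesawQuot(q₁,q₂)) = θ¹_{Φ₁}(ξ, q₁) · θ²_{Φ₂}(ξ, q₂)` on
`[GU] × [U₁] × [U₂]`. [cite: Kudla1984, §1] -/
theorem IsSeesawProduct.thetaKer_seesawQuot {Ψ : SX} {Φ₁ : SX₁} {Φ₂ : SX₂}
    (h : IsSeesawProduct M M₁ M₂ bd Ψ Φ₁ Φ₂) (ξ : GU ⧸ ΓU) (q₁ : U₁ ⧸ Γ₁) (q₂ : U₂ ⧸ Γ₂) :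
    M.thetaKer Ψ (ξ, seesawQuot bd hbd (q₁, q₂)) = M₁.thetaKer Φ₁ (ξ, q₁) * M₂.thetaKer Φ₂ (ξ, q₂) := by
  induction ξ using QuotientGroup.induction_on with
  | H x =>
    induction q₁ using QuotientGroup.induction_on with
    | H u₁ =>
      induction q₂ using QuotientGroup.induction_on with
      | H u₂ => rw [seesawQuot_mk, thetaKer_mk, thetaKer_mk, thetaKer_mk]; exact h x u₁ u₂

variable [CompactSpace (GU ⧸ ΓU)]
  [CompactSpace (U₁ ⧸ Γ₁)] [MeasurableSpace (U₁ ⧸ Γ₁)] [BorelSpace (U₁ ⧸ Γ₁)]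
  (μ₁ : Measure (U₁ ⧸ Γ₁)) [IsFiniteMeasure μ₁]
  [CompactSpace (U₂ ⧸ Γ₂)] [MeasurableSpace (U₂ ⧸ Γ₂)] [BorelSpace (U₂ ⧸ Γ₂)]
  (μ₂ : Measure (U₂ ⧸ Γ₂)) [IsFiniteMeasure μ₂]

/-- **THE SEE-SAW IDENTITY FOR THETA LIFTS**: the period of the big theta kernel over the see-saw torus against
`f₁ ⊠ f₂` is the product of the two small theta lifts —
`∫_{[U₁] × [U₂]} θ_Ψ(ξ, bd(q₁,q₂)) f₁(q₁) f₂(q₂) d(μ₁ ⊗ μ₂) = Θ¹_{Φ₁}(f₁)(ξ) · Θ²_{Φ₂}(f₂)(ξ)`.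
[cite: Kudla1984, §1] -/
theorem seesaw_period_eq_thetaLift_mul {Ψ : SX} {Φ₁ : SX₁} {Φ₂ : SX₂}
    (h : IsSeesawProduct M M₁ M₂ bd Ψ Φ₁ Φ₂) (f₁ : C(U₁ ⧸ Γ₁, ℂ)) (f₂ : C(U₂ ⧸ Γ₂, ℂ)) (ξ : GU ⧸ ΓU) :
    ∫ q : (U₁ ⧸ Γ₁) × (U₂ ⧸ Γ₂), M.thetaKer Ψ (ξ, seesawQuot bd hbd q) * (f₁ q.1 * f₂ q.2) ∂(μ₁.prod μ₂) =
      M₁.thetaLift μ₁ Φ₁ f₁ ξ * M₂.thetaLift μ₂ Φ₂ f₂ ξ := by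
  have hint : (fun q : (U₁ ⧸ Γ₁) × (U₂ ⧸ Γ₂) => M.thetaKer Ψ (ξ, seesawQuot bd hbd q) * (f₁ q.1 * f₂ q.2)) =
      fun q => (M₁.thetaKer Φ₁ (ξ, q.1) * f₁ q.1) * (M₂.thetaKer Φ₂ (ξ, q.2) * f₂ q.2) := by
    funext q
    rw [show seesawQuot bd hbd q = seesawQuot bd hbd (q.1, q.2) from rfl, h.thetaKer_seesawQuot hbd ξ q.1 q.2]
    ring
  rw [hint, M₁.thetaLift_apply, M₂.thetaLift_apply]
  exact integral_prod_mul (fun a => M₁.thetaKer Φ₁ (ξ, a) * f₁ a) (fun b => M₂.thetaKer Φ₂ (ξ, b) * f₂ b)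

/-- **… read on the group** (`thetaLiftFun`, the convention of `Automorphic.weightForms`): for `g ∈ GU`,
`∫ θ_Ψ(g⁻¹ ΓU, bd(q₁,q₂)) f₁(q₁) f₂(q₂) = Θ̃¹_{Φ₁}(f₁)(g) · Θ̃²_{Φ₂}(f₂)(g)`. [cite: Kudla1984, §1] -/
theorem seesaw_period_eq_thetaLiftFun_mul {Ψ : SX} {Φ₁ : SX₁} {Φ₂ : SX₂}
    (h : IsSeesawProduct M M₁ M₂ bd Ψ Φ₁ Φ₂) (f₁ : C(U₁ ⧸ Γ₁, ℂ)) (f₂ : C(U₂ ⧸ Γ₂, ℂ)) (g : GU) :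
    ∫ q : (U₁ ⧸ Γ₁) × (U₂ ⧸ Γ₂), M.thetaKer Ψ (QuotientGroup.mk g⁻¹, seesawQuot bd hbd q) * (f₁ q.1 * f₂ q.2)
        ∂(μ₁.prod μ₂) =
      M₁.thetaLiftFun μ₁ Φ₁ f₁ g * M₂.thetaLiftFun μ₂ Φ₂ f₂ g :=
  seesaw_period_eq_thetaLift_mul hbd μ₁ μ₂ h f₁ f₂ _

/-! ## §3 The antisymmetrised (WEDGE) form -/

/-- **The wedge period is the `2 × 2` determinant of lifts**: for a big test function `Ψ′` whose kernel is the
difference of two product kernels — `θ_{Ψ′} = θ_{Ψ₁₁,₂₂} − θ_{Ψ₁₂,₂₁}` on representatives, `Ψ_{ab,cd}` having product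
kernel `θ¹_{φ₁a} θ²_{φ₂d}` — the see-saw period of `θ_{Ψ′}` against `f₁ ⊠ f₂` is
`Θ¹_{φ₁₁}(f₁) Θ²_{φ₂₂}(f₂) − Θ¹_{φ₁₂}(f₁) Θ²_{φ₂₁}(f₂)` at `ξ`. [cite: Kudla1984, §1] -/
theorem seesaw_period_wedge_eq_det {Ψ' Ψ₁ Ψ₂ : SX} {φ₁₁ φ₁₂ : SX₁} {φ₂₁ φ₂₂ : SX₂}
    (hΨ' : ∀ (x : GU) (y : G), M.thetaFun Ψ' (x, y) = M.thetaFun Ψ₁ (x, y) - M.thetaFun Ψ₂ (x, y))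
    (h₁ : IsSeesawProduct M M₁ M₂ bd Ψ₁ φ₁₁ φ₂₂) (h₂ : IsSeesawProduct M M₁ M₂ bd Ψ₂ φ₁₂ φ₂₁)
    (f₁ : C(U₁ ⧸ Γ₁, ℂ)) (f₂ : C(U₂ ⧸ Γ₂, ℂ)) (ξ : GU ⧸ ΓU) :
    ∫ q : (U₁ ⧸ Γ₁) × (U₂ ⧸ Γ₂), M.thetaKer Ψ' (ξ, seesawQuot bd hbd q) * (f₁ q.1 * f₂ q.2) ∂(μ₁.prod μ₂) =
      M₁.thetaLift μ₁ φ₁₁ f₁ ξ * M₂.thetaLift μ₂ φ₂₂ f₂ ξ -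
        M₁.thetaLift μ₁ φ₁₂ f₁ ξ * M₂.thetaLift μ₂ φ₂₁ f₂ ξ := by
  have hker : ∀ q : (U₁ ⧸ Γ₁) × (U₂ ⧸ Γ₂), M.thetaKer Ψ' (ξ, seesawQuot bd hbd q) =
      M.thetaKer Ψ₁ (ξ, seesawQuot bd hbd q) - M.thetaKer Ψ₂ (ξ, seesawQuot bd hbd q) := by
    intro q
    induction ξ using QuotientGroup.induction_on with
    | H x =>
      rcases q with ⟨q₁, q₂⟩
      induction q₁ using QuotientGroup.induction_on with
      | H u₁ =>
        induction q₂ using QuotientGroup.induction_on with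
        | H u₂ => rw [seesawQuot_mk, thetaKer_mk, thetaKer_mk, thetaKer_mk]; exact hΨ' x (bd (u₁, u₂))
  have hint : (fun q : (U₁ ⧸ Γ₁) × (U₂ ⧸ Γ₂) => M.thetaKer Ψ' (ξ, seesawQuot bd hbd q) * (f₁ q.1 * f₂ q.2)) =
      fun q => (M₁.thetaKer φ₁₁ (ξ, q.1) * f₁ q.1) * (M₂.thetaKer φ₂₂ (ξ, q.2) * f₂ q.2) -
        (M₁.thetaKer φ₁₂ (ξ, q.1) * f₁ q.1) * (M₂.thetaKer φ₂₁ (ξ, q.2) * f₂ q.2) := by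
    funext q
    rw [hker q, show seesawQuot bd hbd q = seesawQuot bd hbd (q.1, q.2) from rfl,
      h₁.thetaKer_seesawQuot hbd ξ q.1 q.2, h₂.thetaKer_seesawQuot hbd ξ q.1 q.2]
    ring
  have hi₁ : Integrable (fun q : (U₁ ⧸ Γ₁) × (U₂ ⧸ Γ₂) =>
      (M₁.thetaKer φ₁₁ (ξ, q.1) * f₁ q.1) * (M₂.thetaKer φ₂₂ (ξ, q.2) * f₂ q.2)) (μ₁.prod μ₂) :=
    (KernelOp.integrable_mul_continuousMap μ₁ ((M₁.thetaKer φ₁₁).curry ξ) f₁).mul_prod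
      (KernelOp.integrable_mul_continuousMap μ₂ ((M₂.thetaKer φ₂₂).curry ξ) f₂)
  have hi₂ : Integrable (fun q : (U₁ ⧸ Γ₁) × (U₂ ⧸ Γ₂) =>
      (M₁.thetaKer φ₁₂ (ξ, q.1) * f₁ q.1) * (M₂.thetaKer φ₂₁ (ξ, q.2) * f₂ q.2)) (μ₁.prod μ₂) :=
    (KernelOp.integrable_mul_continuousMap μ₁ ((M₁.thetaKer φ₁₂).curry ξ) f₁).mul_prod
      (KernelOp.integrable_mul_continuousMap μ₂ ((M₂.thetaKer φ₂₁).curry ξ) f₂)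
  rw [hint, integral_sub hi₁ hi₂, M₁.thetaLift_apply, M₂.thetaLift_apply, M₁.thetaLift_apply, M₂.thetaLift_apply]
  exact congrArg₂ (· - ·)
    (integral_prod_mul (fun a => M₁.thetaKer φ₁₁ (ξ, a) * f₁ a) (fun b => M₂.thetaKer φ₂₂ (ξ, b) * f₂ b))
    (integral_prod_mul (fun a => M₁.thetaKer φ₁₂ (ξ, a) * f₁ a) (fun b => M₂.thetaKer φ₂₁ (ξ, b) * f₂ b))

end Product

end ThetaKernelDatum

end Literature.NumberTheory.Weil1964

end
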